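import Mathlib
import HarnessLib

/-!
# The CRAMÉR–WOLD DEVICE: random vectors in a finite-dimensional inner product space converge
# in distribution iff every one-dimensional projection does

HONEST FRAMING: exact (Metropolis-corrected) sampling algorithms for lattice gauge theory;
figures of merit are autocorrelation/cost numbers at stated couplings and volumes; no
continuum-physics claim.

Venture `LatticeQCDFlow` (cell pub-lqcd), topic `Scoring`; FANOUT row 4 (`s0-u1-b`, rung S0-B).
A printed card is a VECTOR of columns (observable, acceptance, ESS fraction, free energy, …),
and every derived column (a ratio of two printed means, `−log` of the acceptance, the two-code
difference) is a smooth function of several jointly fluctuating coordinates; the one-column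
central limit theorems of the `Scoring/` packet were each assembled by hand.  The general
reduction of JOINT convergence in distribution to one-dimensional statements is the
Cramér–Wold device, which Mathlib does not have; this file proves it for statistics with values
in a finite-dimensional real inner product space `E` (e.g. `EuclideanSpace ℝ (Fin d)`), for an
arbitrary sequence of probability spaces `(Ωₙ, Pₙ)` (triangular arrays allowed):
**`tendstoInDistribution_iff_forall_inner`** — `Xₙ ⇒ Z` in `E` iff `⟪t, Xₙ⟫ ⇒ ⟪t, Z⟫` in `ℝ`
for every `t ∈ E`.  The proof is two applications of Lévy's continuity theorem
(`ProbabilityMeasure.tendsto_iff_tendsto_charFun`, stated in Mathlib for finite-dimensional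
inner product spaces) and the identity `φ_X(t) = φ_{⟪t,X⟫}(1)`
(**`charFun_map_eq_charFun_map_inner`**).  It feeds `Scoring/MultivariateCLT`.  NEW WORK of the
cell (the classical theorem of Cramér and Wold, 1936; our formalisation); no definition;
nothing cited as a fact.

## Content

* `charFun_eq_charFun_map_inner`, `charFun_map_eq_charFun_map_inner` — `φ_μ(t) = φ_{⟪t,·⟫∗μ}(1)`;
* **`tendstoInDistribution_iff_forall_inner`** — the Cramér–Wold device;
* `tendstoInDistribution_of_forall_inner` — the useful direction as an implication.

NOT CLAIMED: infinite-dimensional spaces; a version for `charFunDual` / Banach spaces; rates.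
-/

noncomputable section

namespace Summit.Ventures.LatticeQCDFlow.Scoring.CardConsistency

open MeasureTheory ProbabilityTheory Filter Complex
open scoped Topology RealInnerProductSpace

variable {E : Type*} [NormedAddCommGroup E] [InnerProductSpace ℝ E] [FiniteDimensional ℝ E]
  [MeasurableSpace E] [BorelSpace E]

/-! ## §1 The characteristic function through one-dimensional projections -/

section CharFun

omit [FiniteDimensional ℝ E] in
/-- `φ_μ(t) = φ_{μ ∘ ⟪t,·⟫⁻¹}(1)`: the characteristic function of a measure on `E` at `t` is the
characteristic function at `1` of its image under the projection `x ↦ ⟪t, x⟫`. [folklore] -/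
theorem charFun_eq_charFun_map_inner (μ : Measure E) (t : E) :
    charFun μ t = charFun (μ.map fun x => ⟪t, x⟫) 1 := by
  rw [charFun_eq_charFunDual_toDualMap, charFunDual_eq_charFun_map_one]
  rfl

omit [FiniteDimensional ℝ E] in
/-- `φ_X(t) = φ_{⟪t, X⟫}(1)` for an a.e.-measurable random vector `X`. [folklore] -/
theorem charFun_map_eq_charFun_map_inner {Ω : Type*} [MeasurableSpace Ω] {P : Measure Ω}
    {X : Ω → E} (hX : AEMeasurable X P) (t : E) :
    charFun (P.map X) t = charFun (P.map fun ω => ⟪t, X ω⟫) 1 := by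
  have hg : AEMeasurable (fun x : E => ⟪t, x⟫) (P.map X) :=
    (continuous_const.inner continuous_id).measurable.aemeasurable
  rw [charFun_eq_charFun_map_inner, AEMeasurable.map_map_of_aemeasurable hg hX]
  rfl

end CharFun

/-! ## §2 The device -/

section Device

variable {Ω : ℕ → Type*} [∀ n, MeasurableSpace (Ω n)] {P : (n : ℕ) → Measure (Ω n)}
  [∀ n, IsProbabilityMeasure (P n)]
variable {Ω' : Type*} [MeasurableSpace Ω'] {P' : Measure Ω'} [IsProbabilityMeasure P']

/-- **THE CRAMÉR–WOLD DEVICE.**  For a.e.-measurable random vectors `Xₙ : Ωₙ → E` on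
probability spaces `(Ωₙ, Pₙ)` and `Z : Ω' → E`, with `E` a finite-dimensional real inner product
space: `Xₙ ⇒ Z` if and only if `⟪t, Xₙ⟫ ⇒ ⟪t, Z⟫` for every `t ∈ E`. [ours] (Cramér–Wold 1936;
`⇒`: continuous mapping; `⇐`: Lévy's continuity theorem on `ℝ` turns each hypothesis into
`φ_{⟪t,Xₙ⟫}(1) → φ_{⟪t,Z⟫}(1)`, i.e. `φ_{Xₙ}(t) → φ_Z(t)`, and Lévy's theorem on `E` concludes) -/
theorem tendstoInDistribution_iff_forall_inner {X : (n : ℕ) → Ω n → E} {Z : Ω' → E}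
    (hX : ∀ n, AEMeasurable (X n) (P n)) (hZ : AEMeasurable Z P') :
    TendstoInDistribution X atTop Z P P' ↔
      ∀ t : E, TendstoInDistribution (fun n ω => ⟪t, X n ω⟫) atTop (fun ω' => ⟪t, Z ω'⟫) P P' := by
  refine ⟨fun h t => h.continuous_comp (continuous_const.inner continuous_id), fun h => ?_⟩
  refine ⟨hX, hZ, ?_⟩
  rw [ProbabilityMeasure.tendsto_iff_tendsto_charFun]
  intro t
  have h1 := (ProbabilityMeasure.tendsto_iff_tendsto_charFun.1 (h t).tendsto) 1
  simp only [ProbabilityMeasure.coe_mk] at h1 ⊢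
  rw [charFun_map_eq_charFun_map_inner hZ]
  refine h1.congr fun n => ?_
  rw [charFun_map_eq_charFun_map_inner (hX n)]

/-- **Cramér–Wold, the working direction**: if `⟪t, Xₙ⟫ ⇒ ⟪t, Z⟫` for every `t`, then
`Xₙ ⇒ Z`. [ours] -/
theorem tendstoInDistribution_of_forall_inner {X : (n : ℕ) → Ω n → E} {Z : Ω' → E}
    (hX : ∀ n, AEMeasurable (X n) (P n)) (hZ : AEMeasurable Z P')
    (h : ∀ t : E, TendstoInDistribution (fun n ω => ⟪t, X n ω⟫) atTop (fun ω' => ⟪t, Z ω'⟫) P P') :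
    TendstoInDistribution X atTop Z P P' :=
  (tendstoInDistribution_iff_forall_inner hX hZ).2 h

end Device

end Summit.Ventures.LatticeQCDFlow.Scoring.CardConsistency

end
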